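import Mathlib
import Literature.AlgebraicGeometry.Resolution.CobordantGame
import Literature.AlgebraicGeometry.Resolution.CobordantChartCoefficients
import Literature.AlgebraicGeometry.Resolution.CobordantChartPlaneSlice
import Literature.AlgebraicGeometry.Resolution.CobordantTupleGame
import Literature.AlgebraicGeometry.Resolution.FormalCoordinateChange
import Summits.ResolutionOfSingularities.ResolutionOfSingularities.Theorems.WeightedInvariantGlobalizeLocalDropCanonize
import Summits.ResolutionOfSingularities.ResolutionOfSingularities.Theorems.WeightedInvariantGlobalizeLocalDropRegularGerms
import Summits.ResolutionOfSingularities.ResolutionOfSingularities.Theorems.WeightedInvariantLocalWeightedDropConeDichotomy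
import Summits.ResolutionOfSingularities.ResolutionOfSingularities.Theorems.WeightedInvariantLocalWeightedDropTangentConeCut
import Summits.ResolutionOfSingularities.ResolutionOfSingularities.Theorems.WeightedInvariantLocalWeightedDropMonicCurveBlowup
import Summits.ResolutionOfSingularities.ResolutionOfSingularities.Theorems.WeightedInvariantLocalWeightedDropMonicDoublePointLift
import Summits.ResolutionOfSingularities.ResolutionOfSingularities.Theorems.WeightedInvariantLocalWeightedDropTerminalDoublePointsAux

/-!
# `WeightedInvariant.LocalWeightedDrop`, line `hasse-ridge-face-selection`: toolkit for the SEPARABLE TERMINAL double points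
# `y² + A₁(x₀,x₁)·y + A₀(x₀,x₁)` (coefficients, the two exits, the curve step)

Crux item stmt-ResolutionOfSingularities-8899 `LocalWeightedDrop` (route `ResolutionOfSingularities/WeightedInvariant`), serving the
door `WeightedConstruction` stmt-ResolutionOfSingularities-0571.  [OURS · L1 W4.3, chain w43, stub worker 2 (gen 2): toolkit for the
proposed v22 piece S2sT `stub_charTwoSeparableTerminalWon` (typed sub-cut of S2s `stub_charTwoSeparableDoublePointWon`, evidence #56 on
stmt-8899); companion of stub worker 3's `TerminalDoublePointsAux` (the case `A₁ = 0`); NOT a statement of any manuscript.]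

Contents (`y = X (Fin.last 2)`, `A₀, A₁ ∈ k[[x₀,x₁]]` embedded along `Fin.succAboveEmb (Fin.last 2)`):
* coefficients of `y² + A₀♮ + A₁♮·y` at the `y`-free exponents (`coeff_embDomain_dp1` = those of `A₀`) and at the exponents of
  `y`-degree one (`coeff_embDomain_add_single_dp1` = those of `A₁`); singular / non-singular criteria (`isSingular_dp1`,
  `not_isSingular_dp1_of_constantCoeff_ne_zero`, `not_isSingular_dp1_of_coeff_single_ne_zero`);
* THE CROSS-TERM EXIT (characteristic `2`, `k = k̄`): a singular germ in three variables whose quadratic part has a non-zero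
  coefficient at `x_a x_b`, `a ≠ b`, is won from the one-variable germs (`won_of_crossCoeff_ne_zero`: by `stub_coneDichotomy` the
  quadratic part is hyperbolic — then `TangentConeCut.hyperbolicStartsWon` — or the square of a linear form, which in characteristic
  `2` has no cross terms); hence `y² + A₀♮ + A₁♮·y` is won as soon as `A₁` has a non-zero LINEAR coefficient
  (`won_dp1_of_coeff_single_A₁_ne_zero`) or `A₀` has a non-zero `x₀x₁`-coefficient (`won_dp1_of_coeff_cross_A₀_ne_zero`);
* THE CURVE STEP `won_dp1_of_curveStep` (every characteristic): if `A₀ = x_i² A₀'`, `A₁ = x_i A₁'` with `A₀'(0) = A₁'(0) = 0`, then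
  `y² + A₀♮ + A₁♮ y` is won as soon as every SINGULAR slice `y² + (c² A₀'(ρ_i))♮ + (c A₁'(ρ_i))♮ y` (`c ≠ 0`,
  `ρ_i : x_i ↦ c x₀, x_{1-i} ↦ x₁`, stub-3's `TerminalDoublePoint.slice_subst_chart`) is won (`won_monic_of_curveBlowup`).
-/

set_option linter.dupNamespace false -- mandated namespace of this single-conjunct summit

namespace Summit.ResolutionOfSingularities.ResolutionOfSingularities.Theorems

open Literature.AlgebraicGeometry.Resolution
open Literature.AlgebraicGeometry.Resolution.CobordantGame

namespace SepTerminalDoublePoint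

open MvPowerSeries

variable {k : Type} [Field k]

/-! ### Coefficients of `y² + A₀♮ + A₁♮·y` -/

/-- An embedded `y`-free exponent has `y`-component `0`. -/
theorem embDomain_apply_last (β : Fin 2 →₀ ℕ) : Finsupp.embDomain (Fin.succAboveEmb (Fin.last 2)) β (Fin.last 2) = 0 :=
  Finsupp.embDomain_notin_range _ _ _ (by simp)

/-- `y = X (Fin.last 2)` does not divide an embedded `y`-free monomial: `¬ e_y ≤ β♮`. -/
theorem not_single_last_le_embDomain (β : Fin 2 →₀ ℕ) :
    ¬ Finsupp.single (Fin.last 2) 1 ≤ Finsupp.embDomain (Fin.succAboveEmb (Fin.last 2)) β := by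
  intro h
  have h1 := h (Fin.last 2)
  rw [Finsupp.single_eq_same, embDomain_apply_last] at h1
  exact absurd h1 (by norm_num)

/-- The coefficient of `A₁♮ · y` at a `y`-free exponent vanishes. -/
theorem coeff_embDomain_rename_mul_X (A₁ : MvPowerSeries (Fin 2) k) (β : Fin 2 →₀ ℕ) :
    coeff (Finsupp.embDomain (Fin.succAboveEmb (Fin.last 2)) β)
      (rename (Fin.succAboveEmb (Fin.last 2)) A₁ * X (Fin.last 2)) = 0 := by
  classical
  rw [mul_comm, X_def, coeff_monomial_mul, if_neg (not_single_last_le_embDomain β)]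

/-- The coefficient of `A₁♮ · y` at `β♮ + e_y` is the coefficient of `A₁` at `β`. -/
theorem coeff_embDomain_add_single_rename_mul_X (A₁ : MvPowerSeries (Fin 2) k) (β : Fin 2 →₀ ℕ) :
    coeff (Finsupp.embDomain (Fin.succAboveEmb (Fin.last 2)) β + Finsupp.single (Fin.last 2) 1)
      (rename (Fin.succAboveEmb (Fin.last 2)) A₁ * X (Fin.last 2)) = coeff β A₁ := by
  classical
  rw [mul_comm, X_def, coeff_monomial_mul, if_pos le_add_self, one_mul, add_tsub_cancel_right, coeff_embDomain_rename]

/-- The coefficient of `A₀♮` at `β♮ + e_y` vanishes (`A₀♮` is `y`-free). -/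
theorem coeff_embDomain_add_single_rename (A₀ : MvPowerSeries (Fin 2) k) (β : Fin 2 →₀ ℕ) :
    coeff (Finsupp.embDomain (Fin.succAboveEmb (Fin.last 2)) β + Finsupp.single (Fin.last 2) 1)
      (rename (Fin.succAboveEmb (Fin.last 2)) A₀) = 0 := by
  apply coeff_rename_eq_zero
  rintro ⟨γ, hγ⟩
  have h := congrArg (fun e => e (Fin.last 2)) hγ
  have hl : (Finsupp.mapDomain (⇑(Fin.succAboveEmb (Fin.last 2))) γ) (Fin.last 2) = 0 :=
    Finsupp.mapDomain_notin_range _ _ (by simp)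
  simp only [Finsupp.coe_add, Pi.add_apply, Finsupp.single_eq_same, hl, embDomain_apply_last] at h
  exact absurd h (by norm_num)

/-- THE `y`-FREE COEFFICIENTS of `y² + A₀♮ + A₁♮ y` are those of `A₀`. -/
theorem coeff_embDomain_dp1 (A₀ A₁ : MvPowerSeries (Fin 2) k) (β : Fin 2 →₀ ℕ) :
    coeff (Finsupp.embDomain (Fin.succAboveEmb (Fin.last 2)) β)
        (X (Fin.last 2) ^ 2 + (rename (Fin.succAboveEmb (Fin.last 2)) A₀ +
          rename (Fin.succAboveEmb (Fin.last 2)) A₁ * X (Fin.last 2))) = coeff β A₀ := by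
  rw [← add_assoc, map_add, TerminalDoublePoint.coeff_embDomain_dp, coeff_embDomain_rename_mul_X, add_zero]

/-- THE `y`-DEGREE-ONE COEFFICIENTS of `y² + A₀♮ + A₁♮ y` are those of `A₁`. -/
theorem coeff_embDomain_add_single_dp1 (A₀ A₁ : MvPowerSeries (Fin 2) k) (β : Fin 2 →₀ ℕ) :
    coeff (Finsupp.embDomain (Fin.succAboveEmb (Fin.last 2)) β + Finsupp.single (Fin.last 2) 1)
        (X (Fin.last 2) ^ 2 + (rename (Fin.succAboveEmb (Fin.last 2)) A₀ +
          rename (Fin.succAboveEmb (Fin.last 2)) A₁ * X (Fin.last 2))) = coeff β A₁ := by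
  classical
  rw [map_add, map_add, coeff_embDomain_add_single_rename, coeff_embDomain_add_single_rename_mul_X, zero_add, coeff_X_pow,
    if_neg, zero_add]
  intro h
  have h2 := congrArg (fun e => e (Fin.last 2)) h
  simp only [Finsupp.coe_add, Pi.add_apply, Finsupp.single_eq_same, embDomain_apply_last] at h2
  exact absurd h2 (by norm_num)

/-- The `x_l`-coefficient of `y² + A₀♮ + A₁♮ y` is the `x_l`-coefficient of `A₀`. -/
theorem coeff_single_castSucc_dp1 (A₀ A₁ : MvPowerSeries (Fin 2) k) (l : Fin 2) (n : ℕ) :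
    coeff (Finsupp.single (Fin.castSucc l) n)
        (X (Fin.last 2) ^ 2 + (rename (Fin.succAboveEmb (Fin.last 2)) A₀ +
          rename (Fin.succAboveEmb (Fin.last 2)) A₁ * X (Fin.last 2))) = coeff (Finsupp.single l n) A₀ := by
  rw [← TerminalDoublePoint.embDomain_single, coeff_embDomain_dp1]

/-- The `y`-coefficient of `y² + A₀♮ + A₁♮ y` is `A₁(0)`. -/
theorem coeff_single_last_dp1 (A₀ A₁ : MvPowerSeries (Fin 2) k) :
    coeff (Finsupp.single (Fin.last 2) 1)
        (X (Fin.last 2) ^ 2 + (rename (Fin.succAboveEmb (Fin.last 2)) A₀ +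
          rename (Fin.succAboveEmb (Fin.last 2)) A₁ * X (Fin.last 2))) = constantCoeff A₁ := by
  have h := coeff_embDomain_add_single_dp1 A₀ A₁ 0
  rw [Finsupp.embDomain_zero, zero_add] at h
  rw [h, coeff_zero_eq_constantCoeff_apply]

/-- The `x_l · y`-coefficient of `y² + A₀♮ + A₁♮ y` is the `x_l`-coefficient of `A₁`. -/
theorem coeff_castSucc_add_last_dp1 (A₀ A₁ : MvPowerSeries (Fin 2) k) (l : Fin 2) :
    coeff (Finsupp.single (Fin.castSucc l) 1 + Finsupp.single (Fin.last 2) 1)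
        (X (Fin.last 2) ^ 2 + (rename (Fin.succAboveEmb (Fin.last 2)) A₀ +
          rename (Fin.succAboveEmb (Fin.last 2)) A₁ * X (Fin.last 2))) = coeff (Finsupp.single l 1) A₁ := by
  rw [← TerminalDoublePoint.embDomain_single, coeff_embDomain_add_single_dp1]

/-- The `x₀x₁`-coefficient of `y² + A₀♮ + A₁♮ y` is the `x₀x₁`-coefficient of `A₀`. -/
theorem coeff_zero_add_one_dp1 (A₀ A₁ : MvPowerSeries (Fin 2) k) :
    coeff (Finsupp.single (0 : Fin 3) 1 + Finsupp.single (1 : Fin 3) 1)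
        (X (Fin.last 2) ^ 2 + (rename (Fin.succAboveEmb (Fin.last 2)) A₀ +
          rename (Fin.succAboveEmb (Fin.last 2)) A₁ * X (Fin.last 2))) =
      coeff (Finsupp.single 0 1 + Finsupp.single 1 1) A₀ := by
  have hexp : (Finsupp.single (0 : Fin 3) 1 + Finsupp.single (1 : Fin 3) 1) =
      Finsupp.embDomain (Fin.succAboveEmb (Fin.last 2)) (Finsupp.single 0 1 + Finsupp.single 1 1) := by
    rw [Finsupp.embDomain_add, TerminalDoublePoint.embDomain_single, TerminalDoublePoint.embDomain_single]
    rfl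
  rw [hexp, coeff_embDomain_dp1]

/-- The constant coefficient of `y² + A₀♮ + A₁♮ y` is `A₀(0)`. -/
theorem constantCoeff_dp1 (A₀ A₁ : MvPowerSeries (Fin 2) k) :
    constantCoeff (X (Fin.last 2) ^ 2 + (rename (Fin.succAboveEmb (Fin.last 2)) A₀ +
        rename (Fin.succAboveEmb (Fin.last 2)) A₁ * X (Fin.last 2))) = constantCoeff A₀ := by
  have h := coeff_embDomain_dp1 A₀ A₁ 0
  rw [Finsupp.embDomain_zero] at h
  rw [← coeff_zero_eq_constantCoeff_apply, h, coeff_zero_eq_constantCoeff_apply]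

/-- `y² + A₀♮ + A₁♮ y ≠ 0`: its `y²`-coefficient is `1`. -/
theorem dp1_ne_zero (A₀ A₁ : MvPowerSeries (Fin 2) k) :
    X (Fin.last 2) ^ 2 + (rename (Fin.succAboveEmb (Fin.last 2)) A₀ +
        rename (Fin.succAboveEmb (Fin.last 2)) A₁ * X (Fin.last 2)) ≠ 0 := by
  classical
  intro h
  have h2 := congrArg (coeff (Finsupp.single (Fin.last 2) 2)) h
  have hA₀ : coeff (Finsupp.single (Fin.last 2) 2) (rename (Fin.succAboveEmb (Fin.last 2)) A₀) = 0 := by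
    apply coeff_rename_eq_zero
    rintro ⟨γ, hγ⟩
    have h' := congrArg (fun e => e (Fin.last 2)) hγ
    simp only [Finsupp.single_eq_same] at h'
    rw [Finsupp.mapDomain_notin_range _ _ (by simp)] at h'
    exact absurd h' (by norm_num)
  have hA₁ : coeff (Finsupp.single (Fin.last 2) 2) (rename (Fin.succAboveEmb (Fin.last 2)) A₁ * X (Fin.last 2)) = 0 := by
    have h' := coeff_embDomain_add_single_rename (k := k) A₁ 0
    rw [Finsupp.embDomain_zero, zero_add] at h'
    rw [mul_comm, X_def, coeff_monomial_mul, if_pos (by rw [Finsupp.single_le_iff]; simp), one_mul,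
      show Finsupp.single (Fin.last 2) 2 - Finsupp.single (Fin.last 2) 1 = Finsupp.single (Fin.last 2) 1 by
        rw [← Finsupp.single_tsub], coeff_rename_eq_zero]
    rintro ⟨γ, hγ⟩
    have h'' := congrArg (fun e => e (Fin.last 2)) hγ
    simp only [Finsupp.single_eq_same] at h''
    rw [Finsupp.mapDomain_notin_range _ _ (by simp)] at h''
    exact absurd h'' (by norm_num)
  rw [map_add, map_add, coeff_X_pow, if_pos rfl, hA₀, hA₁, map_zero] at h2
  norm_num at h2

/-- SINGULARITY CRITERION: `y² + A₀♮ + A₁♮ y` is singular when `A₀` has no constant and no linear terms and `A₁(0) = 0`. -/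
theorem isSingular_dp1 {A₀ A₁ : MvPowerSeries (Fin 2) k} (h0 : constantCoeff A₀ = 0)
    (h1 : ∀ l : Fin 2, coeff (Finsupp.single l 1) A₀ = 0) (hA₁ : constantCoeff A₁ = 0) :
    CobordantGame.IsSingular k (X (Fin.last 2) ^ 2 + (rename (Fin.succAboveEmb (Fin.last 2)) A₀ +
      rename (Fin.succAboveEmb (Fin.last 2)) A₁ * X (Fin.last 2))) := by
  refine ⟨dp1_ne_zero A₀ A₁, by rw [constantCoeff_dp1]; exact h0, fun j => ?_⟩
  rcases Fin.eq_castSucc_or_eq_last j with ⟨l, rfl⟩ | rfl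
  · rw [coeff_single_castSucc_dp1]; exact h1 l
  · rw [coeff_single_last_dp1]; exact hA₁

/-- `y² + A₀♮ + A₁♮ y` is NOT singular when `A₁(0) ≠ 0` (the linear term `A₁(0)·y`). -/
theorem not_isSingular_dp1_of_constantCoeff_ne_zero {A₀ A₁ : MvPowerSeries (Fin 2) k} (hA₁ : constantCoeff A₁ ≠ 0) :
    ¬ CobordantGame.IsSingular k (X (Fin.last 2) ^ 2 + (rename (Fin.succAboveEmb (Fin.last 2)) A₀ +
      rename (Fin.succAboveEmb (Fin.last 2)) A₁ * X (Fin.last 2))) := fun hS =>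
  hA₁ (by rw [← coeff_single_last_dp1 A₀ A₁]; exact hS.2.2 _)

/-- `y² + A₀♮ + A₁♮ y` is NOT singular when `A₀` has a non-zero linear coefficient. -/
theorem not_isSingular_dp1_of_coeff_single_ne_zero {A₀ A₁ : MvPowerSeries (Fin 2) k} (l : Fin 2)
    (h : coeff (Finsupp.single l 1) A₀ ≠ 0) :
    ¬ CobordantGame.IsSingular k (X (Fin.last 2) ^ 2 + (rename (Fin.succAboveEmb (Fin.last 2)) A₀ +
      rename (Fin.succAboveEmb (Fin.last 2)) A₁ * X (Fin.last 2))) := fun hS =>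
  h (by rw [← coeff_single_castSucc_dp1 A₀ A₁ l 1]; exact hS.2.2 _)

/-! ### The cross-term exit (characteristic 2) -/

/-- THE CROSS-TERM EXIT.  Over an algebraically closed field of characteristic `2`, a singular germ `f ∈ k[[x₀,x₁,x₂]]` whose
quadratic part has a non-zero coefficient at `x_a x_b`, `a ≠ b`, is won from the singular one-variable germs: by
`stub_coneDichotomy` the quadratic part is hyperbolic (then `TangentConeCut.hyperbolicStartsWon`) or a square `(Σ ℓ_l x_l)²`, whose
`x_a x_b`-coefficient is `2 ℓ_a ℓ_b = 0`. -/
theorem won_of_crossCoeff_ne_zero [CharP k 2] [IsAlgClosed k]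
    (hlow : ∀ g : MvPowerSeries (Fin 1) k, CobordantGame.IsSingular k g → CobordantGame.Won k 1 g)
    (f : MvPowerSeries (Fin 3) k) (hf : CobordantGame.IsSingular k f) {a b : Fin 3} (hab : a ≠ b)
    (hc : coeff (Finsupp.single a 1 + Finsupp.single b 1) f ≠ 0) : CobordantGame.Won k 3 f := by
  rcases stub_coneDichotomy k 1 f hf with h | ⟨ℓ, hℓ⟩
  · exact TangentConeCut.hyperbolicStartsWon (n := 0) hlow f hf h
  · exfalso
    apply hc
    rw [hℓ a b, ConeDichotomy.sq_linear_eq_quadP, ConeDichotomy.coeff_pair_quadP, if_neg hab]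
    simp only [Matrix.of_apply]
    rw [mul_comm (ℓ b), CharTwo.add_self_eq_zero]

/-- EXIT 1 for `y² + A₀♮ + A₁♮ y` (characteristic 2): if the germ is singular and `A₁` has a non-zero LINEAR coefficient, the
quadratic part has the cross term `x_l · y` and the germ is won. -/
theorem won_dp1_of_coeff_single_A₁_ne_zero [CharP k 2] [IsAlgClosed k]
    (hlow : ∀ g : MvPowerSeries (Fin 1) k, CobordantGame.IsSingular k g → CobordantGame.Won k 1 g)
    {A₀ A₁ : MvPowerSeries (Fin 2) k}
    (hS : CobordantGame.IsSingular k (X (Fin.last 2) ^ 2 + (rename (Fin.succAboveEmb (Fin.last 2)) A₀ +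
      rename (Fin.succAboveEmb (Fin.last 2)) A₁ * X (Fin.last 2))))
    (l : Fin 2) (h : coeff (Finsupp.single l 1) A₁ ≠ 0) :
    CobordantGame.Won k 3 (X (Fin.last 2) ^ 2 + (rename (Fin.succAboveEmb (Fin.last 2)) A₀ +
      rename (Fin.succAboveEmb (Fin.last 2)) A₁ * X (Fin.last 2))) :=
  won_of_crossCoeff_ne_zero hlow _ hS (a := Fin.castSucc l) (b := Fin.last 2) (Fin.castSucc_lt_last l).ne
    (by rw [coeff_castSucc_add_last_dp1]; exact h)

/-- EXIT 2 for `y² + A₀♮ + A₁♮ y` (characteristic 2): if the germ is singular and `A₀` has a non-zero `x₀x₁`-coefficient, the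
germ is won (the hyperbolic bottom `y² + x₀x₁·U + A₁ y`). -/
theorem won_dp1_of_coeff_cross_A₀_ne_zero [CharP k 2] [IsAlgClosed k]
    (hlow : ∀ g : MvPowerSeries (Fin 1) k, CobordantGame.IsSingular k g → CobordantGame.Won k 1 g)
    {A₀ A₁ : MvPowerSeries (Fin 2) k}
    (hS : CobordantGame.IsSingular k (X (Fin.last 2) ^ 2 + (rename (Fin.succAboveEmb (Fin.last 2)) A₀ +
      rename (Fin.succAboveEmb (Fin.last 2)) A₁ * X (Fin.last 2))))
    (h : coeff (Finsupp.single 0 1 + Finsupp.single 1 1) A₀ ≠ 0) :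
    CobordantGame.Won k 3 (X (Fin.last 2) ^ 2 + (rename (Fin.succAboveEmb (Fin.last 2)) A₀ +
      rename (Fin.succAboveEmb (Fin.last 2)) A₁ * X (Fin.last 2))) :=
  won_of_crossCoeff_ne_zero hlow _ hS (a := (0 : Fin 3)) (b := (1 : Fin 3)) (by decide)
    (by rw [coeff_zero_add_one_dp1]; exact h)

/-! ### The curve step on `y² + A₀♮ + A₁♮ y` -/

/-- If `A = x_i · A'` then the `x_i`-coefficient of `A` is `A'(0)`. -/
theorem coeff_single_X_mul (i : Fin 2) (A' : MvPowerSeries (Fin 2) k) :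
    coeff (Finsupp.single i 1) (X i * A') = constantCoeff A' := by
  classical
  rw [X_def, coeff_monomial_mul, if_pos le_rfl, tsub_self, one_mul, coeff_zero_eq_constantCoeff_apply]

/-- THE CURVE STEP (every characteristic `p`).  If `A₀ = x_i² · A₀'` and `A₁ = x_i · A₁'` with `A₀'(0) = A₁'(0) = 0`, blowing up
`V(x_i, y)` (`won_monic_of_curveBlowup`) wins `y² + A₀♮ + A₁♮ y` as soon as every SINGULAR slice
`y² + (c² · A₀'(ρ_i))♮ + (c · A₁'(ρ_i))♮ y` (`c ≠ 0`) is won. -/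
theorem won_dp1_of_curveStep (p : ℕ) (hp : p.Prime) (k : Type) [Field k] [CharP k p] (i : Fin 2)
    (A₀ A₁ A₀' A₁' : MvPowerSeries (Fin 2) k) (hdiv₀ : A₀ = X i ^ 2 * A₀') (hdiv₁ : A₁ = X i * A₁')
    (h0 : constantCoeff A₀' = 0) (h1 : constantCoeff A₁' = 0)
    (hsucc : ∀ c : k, c ≠ 0 →
      CobordantGame.IsSingular k (X (Fin.last 2) ^ 2 + (rename (Fin.succAboveEmb (Fin.last 2))
        (C (c ^ 2) * subst (fun l : Fin 2 => if l = i then C c * X 0 else (X 1 : MvPowerSeries (Fin 2) k)) A₀') +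
        rename (Fin.succAboveEmb (Fin.last 2))
          (C c * subst (fun l : Fin 2 => if l = i then C c * X 0 else (X 1 : MvPowerSeries (Fin 2) k)) A₁') *
          X (Fin.last 2))) →
      CobordantGame.Won k 3 (X (Fin.last 2) ^ 2 + (rename (Fin.succAboveEmb (Fin.last 2))
        (C (c ^ 2) * subst (fun l : Fin 2 => if l = i then C c * X 0 else (X 1 : MvPowerSeries (Fin 2) k)) A₀') +
        rename (Fin.succAboveEmb (Fin.last 2))
          (C c * subst (fun l : Fin 2 => if l = i then C c * X 0 else (X 1 : MvPowerSeries (Fin 2) k)) A₁') *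
          X (Fin.last 2)))) :
    CobordantGame.Won k 3 (X (Fin.last 2) ^ 2 + (rename (Fin.succAboveEmb (Fin.last 2)) A₀ +
      rename (Fin.succAboveEmb (Fin.last 2)) A₁ * X (Fin.last 2))) := by
  classical
  rw [MonicDoublePointLift.monic_two_eq_sum A₀ A₁]
  refine won_monic_of_curveBlowup p hp k 2 2 two_pos i (![A₀, A₁]) (![A₀', A₁']) ?_ ?_ ?_
  · intro j
    fin_cases j
    · simpa using hdiv₀
    · simpa using hdiv₁
  · intro j
    fin_cases j
    · simpa using h0
    · simpa using h1
  · intro c hc hS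
    have hSeq : X (Fin.last 2) ^ 2 + ∑ j : Fin 2, rename (Fin.succAboveEmb (Fin.last 2))
        (C (c ^ (2 - (j : ℕ))) * TupleGame.slice i (subst (CobordantChart.chart (fun l : Fin 2 => if l = i then 1 else 0)
          (fun l : Fin 2 => if l = i then c else 0)) ((![A₀', A₁'] : Fin 2 → MvPowerSeries (Fin 2) k) j))) *
          X (Fin.last 2) ^ (j : ℕ) =
        X (Fin.last 2) ^ 2 + (rename (Fin.succAboveEmb (Fin.last 2))
          (C (c ^ 2) * subst (fun l : Fin 2 => if l = i then C c * X 0 else (X 1 : MvPowerSeries (Fin 2) k)) A₀') +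
          rename (Fin.succAboveEmb (Fin.last 2))
            (C c * subst (fun l : Fin 2 => if l = i then C c * X 0 else (X 1 : MvPowerSeries (Fin 2) k)) A₁') *
            X (Fin.last 2)) := by
      rw [Fin.sum_univ_two]
      simp only [Matrix.cons_val_zero, Matrix.cons_val_one, Fin.val_zero, Fin.val_one,
        Nat.sub_zero, Nat.add_one_sub_one, pow_zero, mul_one, pow_one, TerminalDoublePoint.slice_subst_chart]
    rw [hSeq] at hS ⊢
    exact hsucc c hc hS

end SepTerminalDoublePoint

end Summit.ResolutionOfSingularities.ResolutionOfSingularities.Theorems
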